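import Summits.QuantumFields.GaugeBoot.BootstrapCertificatesSuN
import Summits.QuantumFields.GaugeBoot.GaugeInvariantBootstrapConvergence
import HarnessLib

/-!
# Certificates on gauge-invariant data: gauge-averaged SOS ⊕ gauge-averaged loop equations are sound and complete (gauge-boot, L1/L4 supplement)

HONEST FRAMING (cell `pub-gaugeboot`, page 1 of every file): the venture produces certified bounds
on lattice expectations at stated coupling, gauge group, dimension and torus size; NOT a mass gap,
NOT a continuum limit, NOT a string tension; NOT Yang–Mills-summit-bearing (barriers
`FixedCouplingUltralocality`, `PerturbativeInvisibility`). Structural; it certifies no number.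

## Content

The bootstrap ON GAUGE-INVARIANT DATA (Anderson–Kruczenski; Kazakov–Zheng 2022/2024: unknowns =
values of gauge-invariant observables; constraints = loop positivity + gauge-averaged multi-trace
loop equations) is, in the tree's form (`GaugeInvariantBootstrap*.lean`), feasibility of `ψ ∘ₗ A`
with `A` the gauge average. Its certificates are the images under `A` of the certificates of
`BootstrapCertificates.lean`:

* `isBootstrapFeasible_comp_iff_isDualFeasible_map` — `ψ ∘ₗ A` is level-`V` feasible iff `ψ` is
  dual feasible for the GAUGE-AVERAGED certificate cone `(certCone … V).map A` (elements
  `Σ_j A(v_j v_j) + Σ_l λ_l A(f_l' - β f_l S_l')`: gauge-averaged squares — the loop-positivity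
  data — plus gauge-averaged rows — the multi-trace loop equations);
* `OrderUnitDuality.orderUnit_map` — a linear image of an order-unit triple is an order-unit
  triple, so `OrderUnitDuality` applies: ★★★ `forall_compFeasible_apply_le_iff`,
  `exists_avg_certificate_of_forall_apply_le` (any lattice, any averaging `A` with `A 1 = 1`);
* `SU(N)` on the torus (`gaugeLevelValuesSuN`): ★★ soundness `gaugeLevelValues_le_of_mem_map_suN`,
  ★★★ no duality gap `forall_gaugeLevelValues_le_iff_suN` / `exists_gauge_certificate_suN` for
  gauge-invariant objectives in the level-`n` certificate domain, and ★★★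
  `exists_gauge_certificate_of_wilson_lt_suN`: every `c > ∫ P dμ_β` for a gauge-invariant polynomial
  observable `P` has, at some level, a certificate `c • 1 - P = A σ + A ρ` made of gauge-averaged
  squares and gauge-averaged loop equations only.

References: Anderson–Kruczenski, Nucl. Phys. B 921 (2017); Kazakov–Zheng, arXiv:2203.11360,
arXiv:2404.16925 §2.3, §3.1; Josz–Henrion, Optim. Lett. 10 (2016) 3. Folklore.
-/

noncomputable section

open MeasureTheory Filter Topology NormedSpace
open Literature.MathematicalPhysics.QuantumFieldTheory (LatticeRep Edge GaugeConfig IsGaugeInvariant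
  wilsonAction wilsonMeasure isProbabilityMeasure_wilsonMeasure)
open Literature.MathematicalPhysics.QuantumLattice

namespace Summit.QuantumFields.GaugeBoot

/-! ## Linear images of order-unit cones -/

namespace OrderUnitDuality

variable {A : Type*} [AddCommGroup A] [Module ℝ A]

/-- Dual feasibility for the image cone is dual feasibility of the pulled-back functional. -/
theorem isDualFeasible_map_iff {K : PointedCone ℝ A} {u : A} (T : A →ₗ[ℝ] A) (ψ : A →ₗ[ℝ] ℝ) :
    IsDualFeasible (K.map T) (T u) ψ ↔ IsDualFeasible K u (ψ ∘ₗ T) := by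
  constructor
  · rintro ⟨hpos, h1⟩
    exact ⟨fun x hx => hpos _ (PointedCone.mem_map.2 ⟨x, hx, rfl⟩), h1⟩
  · rintro ⟨hpos, h1⟩
    refine ⟨fun y hy => ?_, h1⟩
    obtain ⟨x, hx, rfl⟩ := PointedCone.mem_map.1 hy
    exact hpos x hx

/-- ★ **A linear image of an order-unit triple `(K, u, E)` is an order-unit triple**
`(T K, T u, T E)`. -/
theorem orderUnit_map {K : PointedCone ℝ A} {u : A} {E : Submodule ℝ A} (T : A →ₗ[ℝ] A)
    (hKE : ∀ x ∈ K, x ∈ E) (hu : u ∈ K) (hE : ∀ x ∈ E, ∃ t : ℝ, t • u - x ∈ K) :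
    (∀ y ∈ K.map T, y ∈ E.map T) ∧ T u ∈ K.map T ∧
      ∀ y ∈ E.map T, ∃ t : ℝ, t • T u - y ∈ K.map T := by
  refine ⟨fun y hy => ?_, PointedCone.mem_map.2 ⟨u, hu, rfl⟩, fun y hy => ?_⟩
  · obtain ⟨x, hx, rfl⟩ := PointedCone.mem_map.1 hy
    exact Submodule.mem_map.2 ⟨x, hKE x hx, rfl⟩
  · obtain ⟨x, hx, rfl⟩ := Submodule.mem_map.1 hy
    obtain ⟨t, ht⟩ := hE x hx
    exact ⟨t, PointedCone.mem_map.2 ⟨t • u - x, ht, by rw [map_sub, map_smul]⟩⟩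

end OrderUnitDuality

open OrderUnitDuality

/-! ## Averaged bootstraps: feasibility of `ψ ∘ₗ A` -/

section General

variable {ι : Type*} [DecidableEq ι] {G : Type*} [Group G] [TopologicalSpace G] (r : LatticeRep G)
  {K : Type*} {k : K → ℝ → G} {S : ι → (ι → G) → ℝ} {β : ℝ}

/-- ★ **Feasibility of `ψ ∘ₗ A` is dual feasibility of `ψ` for the averaged certificate cone**
`(certCone V).map A` (any linear `A` with `A 1 = 1`; local actions with polynomial derivatives).
[folklore] -/
theorem isBootstrapFeasible_comp_iff_isDualFeasible_map
    (hS : ∀ (i : ι) (a : K), ∃ S' ∈ polyAlgebra (ι := ι) r,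
      ∀ U, HasDerivAt (fun t => S i (Function.update U i (k a t * U i))) (S' U) 0)
    (A : C(ι → G, ℝ) →ₗ[ℝ] C(ι → G, ℝ)) (hA1 : A 1 = 1) {V : Set C(ι → G, ℝ)}
    {ψ : C(ι → G, ℝ) →ₗ[ℝ] ℝ} :
    IsBootstrapFeasible r k S β V (ψ ∘ₗ A) ↔ IsDualFeasible ((certCone r k S β V).map A) 1 ψ := by
  rw [isBootstrapFeasible_iff_isDualFeasible r hS]
  conv_rhs => rw [← hA1]
  exact (isDualFeasible_map_iff A ψ).symm

/-- ★★★ **No duality gap for averaged bootstraps.** Local actions with polynomial derivatives,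
`A` linear with `A 1 = 1`, some `ψ₀ ∘ₗ A` level-`n` feasible, `P ∈ A (certDomain n)`: `ψ P ≤ c`
for every `ψ` with `ψ ∘ₗ A` level-`n` feasible iff `(c + ε) • 1 - P ∈ A (certCone n)` for every
`ε > 0` — a certificate made of `A`-averaged squares and `A`-averaged rows. [folklore] -/
theorem forall_compFeasible_apply_le_iff
    (hS : ∀ (i : ι) (a : K), ∃ S' ∈ polyAlgebra (ι := ι) r,
      ∀ U, HasDerivAt (fun t => S i (Function.update U i (k a t * U i))) (S' U) 0)
    (A : C(ι → G, ℝ) →ₗ[ℝ] C(ι → G, ℝ)) (hA1 : A 1 = 1) {n : ℕ}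
    (h0 : ∃ ψ₀ : C(ι → G, ℝ) →ₗ[ℝ] ℝ,
      IsBootstrapFeasible r k S β (wordTruncation (ι := ι) r n) (ψ₀ ∘ₗ A))
    {P : C(ι → G, ℝ)} (hP : P ∈ (certDomain r k S β n).map A) {c : ℝ} :
    (∀ ψ : C(ι → G, ℝ) →ₗ[ℝ] ℝ,
      IsBootstrapFeasible r k S β (wordTruncation (ι := ι) r n) (ψ ∘ₗ A) → ψ P ≤ c) ↔
      ∀ ε : ℝ, 0 < ε → (c + ε) • (1 : C(ι → G, ℝ)) - P ∈
        (certCone r k S β (wordTruncation (ι := ι) r n)).map A := by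
  obtain ⟨hKE, h1, hE⟩ := certCone_orderUnit r (k := k) (S := S) (β := β) n
  obtain ⟨hKE', h1', hE'⟩ := orderUnit_map A hKE h1 hE
  rw [hA1] at h1' hE'
  have h0' : ∃ ψ₀, IsDualFeasible ((certCone r k S β (wordTruncation (ι := ι) r n)).map A) 1 ψ₀ := by
    obtain ⟨ψ₀, hψ₀⟩ := h0
    exact ⟨ψ₀, (isBootstrapFeasible_comp_iff_isDualFeasible_map r hS A hA1).1 hψ₀⟩
  rw [← OrderUnitDuality.forall_apply_le_iff _ hKE' h1' hE' h0' hP]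
  simp only [isBootstrapFeasible_comp_iff_isDualFeasible_map r hS A hA1]

/-- ★★★ **Averaged certificates exist for every constant above the averaged-SDP maximum**:
`c' • 1 - P = A σ + A ρ` with `σ` an SOS of level-`n` test functions and `ρ` a combination of
level-`n` row elements. [folklore] -/
theorem exists_avg_certificate_of_forall_apply_le
    (hS : ∀ (i : ι) (a : K), ∃ S' ∈ polyAlgebra (ι := ι) r,
      ∀ U, HasDerivAt (fun t => S i (Function.update U i (k a t * U i))) (S' U) 0)
    (A : C(ι → G, ℝ) →ₗ[ℝ] C(ι → G, ℝ)) (hA1 : A 1 = 1) {n : ℕ}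
    (h0 : ∃ ψ₀ : C(ι → G, ℝ) →ₗ[ℝ] ℝ,
      IsBootstrapFeasible r k S β (wordTruncation (ι := ι) r n) (ψ₀ ∘ₗ A))
    {P : C(ι → G, ℝ)} (hP : P ∈ (certDomain r k S β n).map A) {c c' : ℝ}
    (h : ∀ ψ : C(ι → G, ℝ) →ₗ[ℝ] ℝ,
      IsBootstrapFeasible r k S β (wordTruncation (ι := ι) r n) (ψ ∘ₗ A) → ψ P ≤ c) (hc : c < c') :
    ∃ σ ∈ sosCone (wordTruncation (ι := ι) r n),
      ∃ ρ ∈ rowSpace r k S β (wordTruncation (ι := ι) r n), A σ + A ρ = c' • (1 : C(ι → G, ℝ)) - P := by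
  have h' := (forall_compFeasible_apply_le_iff r hS A hA1 h0 hP).1 h (c' - c) (sub_pos.2 hc)
  rw [add_sub_cancel] at h'
  obtain ⟨x, hx, hAx⟩ := PointedCone.mem_map.1 h'
  obtain ⟨σ, hσ, ρ, hρ, rfl⟩ := (mem_certCone_iff r).1 hx
  exact ⟨σ, hσ, ρ, hρ, by rw [← map_add, hAx]⟩

/-- ★★ **Soundness of averaged certificates**: `c • 1 - P ∈ A (certCone V)` gives `ψ P ≤ c`
whenever `ψ ∘ₗ A` is feasible. [folklore] -/
theorem apply_le_of_mem_map_certCone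
    (A : C(ι → G, ℝ) →ₗ[ℝ] C(ι → G, ℝ)) (hA1 : A 1 = 1) {V : Set C(ι → G, ℝ)}
    {ψ : C(ι → G, ℝ) →ₗ[ℝ] ℝ} (hψ : IsBootstrapFeasible r k S β V (ψ ∘ₗ A)) {P : C(ι → G, ℝ)}
    {c : ℝ} (hc : c • (1 : C(ι → G, ℝ)) - P ∈ (certCone r k S β V).map A) : ψ P ≤ c := by
  obtain ⟨x, hx, hAx⟩ := PointedCone.mem_map.1 hc
  have h := hψ.nonneg_of_mem_certCone r hx
  have h1 : ψ 1 = 1 := by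
    have h1' := hψ.1
    rwa [LinearMap.comp_apply, hA1] at h1'
  rw [LinearMap.comp_apply, hAx, map_sub, map_smul, h1, smul_eq_mul, mul_one] at h
  linarith

end General

/-! ## `SU(N)` on the torus: certificates on gauge-invariant data -/

section SuN

variable {d L : ℕ} [NeZero L] (N : ℕ) (β : ℝ)

/-- **The gauge-averaged level-`n` certificate cone** of the `SU(N)` torus bootstrap: images under
the gauge average `A` of the level-`n` certificates — gauge-averaged squares (loop positivity) plus
gauge-averaged Schwinger–Dyson rows (multi-trace loop equations). [folklore] -/
abbrev gaugeCertConeSuN (n : ℕ) :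
    PointedCone ℝ C(GaugeConfig d L (Matrix.specialUnitaryGroup (Fin N) ℂ), ℝ) :=
  (certConeSuN (d := d) (L := L) N β n).map
    (gaugeAvgL d L (Matrix.specialUnitaryGroup (Fin N) ℂ))

/-- The Wilson functional is feasible for the bootstrap on gauge-invariant data at every level. -/
theorem exists_gaugeFeasible_suN (n : ℕ) :
    ∃ ψ₀ : C(GaugeConfig d L (Matrix.specialUnitaryGroup (Fin N) ℂ), ℝ) →ₗ[ℝ] ℝ,
      IsBootstrapFeasible (fundamentalLatticeRep N) (suExp N)
        (fun _ => wilsonAction (fundamentalRep (Fin N))) β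
        (wordTruncation (ι := Edge d L) (fundamentalLatticeRep N) n)
        (ψ₀ ∘ₗ gaugeAvgL d L (Matrix.specialUnitaryGroup (Fin N) ℂ)) := by
  haveI : IsProbabilityMeasure (wilsonMeasure (d := d) (L := L) (fundamentalRep (Fin N)) β) :=
    isProbabilityMeasure_wilsonMeasure (ρ := fundamentalRep (Fin N)) (continuous_fundamentalRep _) β
  exact ⟨_, isBootstrapFeasible_wilson_comp_gaugeAvgL_suN N β _ rfl
    (wordTruncation_subset_polyAlgebra _ n)⟩

/-- A gauge-invariant objective of the level-`n` certificate domain is in its gauge-averaged image. -/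
theorem mem_map_certDomainSuN_of_isGaugeInvariant {n : ℕ}
    {P : C(GaugeConfig d L (Matrix.specialUnitaryGroup (Fin N) ℂ), ℝ)} (hPi : IsGaugeInvariant (⇑P))
    (hP : P ∈ certDomainSuN (d := d) (L := L) N β n) :
    P ∈ (certDomainSuN (d := d) (L := L) N β n).map
      (gaugeAvgL d L (Matrix.specialUnitaryGroup (Fin N) ℂ)) :=
  Submodule.mem_map.2 ⟨P, hP, gaugeAvgL_of_isGaugeInvariant hPi⟩

/-- ★★ **Soundness on gauge-invariant data**: a gauge-averaged certificate `c • 1 - P ∈ A K_n`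
bounds every level-`n` feasible value of the bootstrap on gauge-invariant data. [folklore] -/
theorem gaugeLevelValues_le_of_mem_map_suN {n : ℕ}
    {P : C(GaugeConfig d L (Matrix.specialUnitaryGroup (Fin N) ℂ), ℝ)} {c : ℝ}
    (hc : c • (1 : C(GaugeConfig d L (Matrix.specialUnitaryGroup (Fin N) ℂ), ℝ)) - P ∈
      gaugeCertConeSuN (d := d) (L := L) N β n) :
    ∀ t ∈ gaugeLevelValuesSuN (d := d) (L := L) N β n P, t ≤ c := by
  rintro t ⟨ψ, hψ, rfl⟩
  exact apply_le_of_mem_map_certCone (fundamentalLatticeRep N) _ gaugeAvgL_one hψ hc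

/-- ★★ **Soundness for the Wilson measure** (gauge-averaged certificates). [folklore] -/
theorem wilson_le_of_mem_map_suN {n : ℕ}
    {P : C(GaugeConfig d L (Matrix.specialUnitaryGroup (Fin N) ℂ), ℝ)} {c : ℝ}
    (hc : c • (1 : C(GaugeConfig d L (Matrix.specialUnitaryGroup (Fin N) ℂ), ℝ)) - P ∈
      gaugeCertConeSuN (d := d) (L := L) N β n) :
    ∫ U, P U ∂(wilsonMeasure (fundamentalRep (Fin N)) β) ≤ c :=
  gaugeLevelValues_le_of_mem_map_suN N β hc _ (wilson_mem_gaugeLevelValues_suN N β n P)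

/-- ★★★ **No duality gap on gauge-invariant data.** For a gauge-invariant `P` in the level-`n`
certificate domain: every level-`n` feasible value (bootstrap on gauge-invariant data) is `≤ c`
iff `(c + ε) • 1 - P` is a gauge-averaged SOS plus gauge-averaged rows for every `ε > 0`.
[folklore] -/
theorem forall_gaugeLevelValues_le_iff_suN {n : ℕ}
    {P : C(GaugeConfig d L (Matrix.specialUnitaryGroup (Fin N) ℂ), ℝ)} (hPi : IsGaugeInvariant (⇑P))
    (hP : P ∈ certDomainSuN (d := d) (L := L) N β n) {c : ℝ} :
    (∀ t ∈ gaugeLevelValuesSuN (d := d) (L := L) N β n P, t ≤ c) ↔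
      ∀ ε : ℝ, 0 < ε → (c + ε) • (1 : C(GaugeConfig d L (Matrix.specialUnitaryGroup (Fin N) ℂ), ℝ))
        - P ∈ gaugeCertConeSuN (d := d) (L := L) N β n := by
  rw [← forall_compFeasible_apply_le_iff (fundamentalLatticeRep N) (wilsonAction_polyDeriv_suN N)
    _ gaugeAvgL_one (exists_gaugeFeasible_suN N β n)
    (mem_map_certDomainSuN_of_isGaugeInvariant N β hPi hP)]
  exact ⟨fun h ψ hψ => h _ ⟨ψ, hψ, rfl⟩, fun h t ⟨ψ, hψ, ht⟩ => ht ▸ h ψ hψ⟩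

/-- ★★★ **Gauge-averaged certificates exist for every constant above the SDP maximum on
gauge-invariant data**: `c' • 1 - P = A σ + A ρ`. [folklore] -/
theorem exists_gauge_certificate_suN {n : ℕ}
    {P : C(GaugeConfig d L (Matrix.specialUnitaryGroup (Fin N) ℂ), ℝ)} (hPi : IsGaugeInvariant (⇑P))
    (hP : P ∈ certDomainSuN (d := d) (L := L) N β n) {c c' : ℝ}
    (h : ∀ t ∈ gaugeLevelValuesSuN (d := d) (L := L) N β n P, t ≤ c) (hc : c < c') :
    ∃ σ ∈ sosCone (wordTruncation (ι := Edge d L) (fundamentalLatticeRep N) n),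
      ∃ ρ ∈ rowSpace (fundamentalLatticeRep N) (suExp N) (fun _ => wilsonAction (fundamentalRep (Fin N)))
        β (wordTruncation (ι := Edge d L) (fundamentalLatticeRep N) n),
        gaugeAvgL d L _ σ + gaugeAvgL d L _ ρ =
          c' • (1 : C(GaugeConfig d L (Matrix.specialUnitaryGroup (Fin N) ℂ), ℝ)) - P :=
  exists_avg_certificate_of_forall_apply_le (fundamentalLatticeRep N) (wilsonAction_polyDeriv_suN N)
    _ gaugeAvgL_one (exists_gaugeFeasible_suN N β n)
    (mem_map_certDomainSuN_of_isGaugeInvariant N β hPi hP) (fun ψ hψ => h _ ⟨ψ, hψ, rfl⟩) hc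

/-- ★★★ **Every strict upper bound on the Wilson expectation of a gauge-invariant polynomial
observable has a certificate made of gauge-averaged squares and gauge-averaged loop equations**
(at some level). [folklore] -/
theorem exists_gauge_certificate_of_wilson_lt_suN
    {P : C(GaugeConfig d L (Matrix.specialUnitaryGroup (Fin N) ℂ), ℝ)}
    (hP : P ∈ polyAlgebra (ι := Edge d L) (fundamentalLatticeRep N)) (hPi : IsGaugeInvariant (⇑P))
    {c : ℝ} (hc : ∫ U, P U ∂(wilsonMeasure (fundamentalRep (Fin N)) β) < c) :
    ∃ n : ℕ, ∃ σ ∈ sosCone (wordTruncation (ι := Edge d L) (fundamentalLatticeRep N) n),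
      ∃ ρ ∈ rowSpace (fundamentalLatticeRep N) (suExp N) (fun _ => wilsonAction (fundamentalRep (Fin N)))
        β (wordTruncation (ι := Edge d L) (fundamentalLatticeRep N) n),
        gaugeAvgL d L _ σ + gaugeAvgL d L _ ρ =
          c • (1 : C(GaugeConfig d L (Matrix.specialUnitaryGroup (Fin N) ℂ), ℝ)) - P := by
  set W := ∫ U, P U ∂(wilsonMeasure (d := d) (L := L) (fundamentalRep (Fin N)) β) with hW
  have hε : 0 < (c - W) / 2 := by linarith
  obtain ⟨n, hn, hPn⟩ := ((gaugeLevelValues_subset_Icc_suN N β hP hPi hε).and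
    (eventually_mem_wordTruncation (fundamentalLatticeRep N) hP)).exists
  exact ⟨n, exists_gauge_certificate_suN N β hPi (mem_certDomainSuN_of_mem_wordTruncation N β
    (Nat.le_add_right n n) hPn) (c := W + (c - W) / 2) (fun t ht => (hn ht).2) (by linarith)⟩

end SuN

end Summit.QuantumFields.GaugeBoot

end
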